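import Literature.NumberTheory.Automorphic.BianchiConeModel
import Mathlib.Analysis.Convex.Contractible
import HarnessLib

/-!
# Translates of a convex, relatively open subset of the cone of binary Hermitian forms

Topic `NumberTheory/Automorphic`; namespace `Literature.NumberTheory.Automorphic`, grouping
sub-namespace `BianchiCone` (sequel of `BianchiConeModel`).  Theorems only; Mathlib + one tree file.

For the cone `𝒫` of positive definite binary Hermitian forms (`BianchiCone.cone`, a convex open cone
in the real vector space of Hermitian `2 × 2` matrices, hence NOT open in `M₂(ℂ)`) with the linear
action `g • H = (g⁻¹)ᴴ H g⁻¹` of `GL₂(ℂ)` (`BianchiCone.act`), and a subset `S ⊆ M₂(ℂ)`, we prove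
([BorelSerre1973, §11]: the symmetric space as a cone of forms and its Siegel sets;
[HatcherAT2002, §2.1]: non-empty convex sets are contractible):

* `mem_image_act_iff` — `H ∈ g • S ↔ g⁻¹ • H ∈ S`;
* `convex_image_act` — translates `g • S` of convex sets are convex (the action is `ℝ`-linear);
* `isOpen_setOf_mem_image_act` — if the trace of `S` on the cone is open in the cone, so is the
  trace of every translate `g • S` (the action is by homeomorphisms of the cone);
* `isOpen_setOf_forall_mem_image_act`, `contractibleSpace_setOf_forall_mem_image_act`,
  `isOpen_contractible_translates` — for finitely many `h_k ∈ GL₂(ℂ)` the set of points of the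
  cone lying in every translate `h_k • S` is open in the cone and, when non-empty and `S` is
  convex, contractible: it is homeomorphic to the convex subset `𝒫 ∩ ⋂ₖ h_k • S` of `M₂(ℂ)`.

This is the "good cover" input of Leray's theorem for the cover of `𝒫` by the translates of a
Siegel domain under an arithmetic group.

## References

* A. Borel, J.-P. Serre, *Corners and arithmetic groups*, Comment. Math. Helv. 48 (1973), §11
  [BorelSerre1973].
* A. Hatcher, *Algebraic Topology*, Cambridge University Press (2002), §2.1 [HatcherAT2002].
-/

noncomputable section

open Matrix Complex
open scoped MatrixGroups

namespace Literature.NumberTheory.Automorphic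

namespace BianchiCone

/-! ### Translates of subsets of `M₂(ℂ)` -/

/-- `g⁻¹ • (g • H) = H`. [folklore] -/
theorem act_inv_act (g : GL (Fin 2) ℂ) (H : Mat) : act g⁻¹ (act g H) = H := by
  rw [← act_mul, inv_mul_cancel, act_one]

/-- `g • (g⁻¹ • H) = H`. [folklore] -/
theorem act_act_inv (g : GL (Fin 2) ℂ) (H : Mat) : act g (act g⁻¹ H) = H := by
  rw [← act_mul, mul_inv_cancel, act_one]

/-- `H ∈ g • S ↔ g⁻¹ • H ∈ S`. [folklore] -/
theorem mem_image_act_iff (g : GL (Fin 2) ℂ) (S : Set Mat) (H : Mat) :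
    H ∈ act g '' S ↔ act g⁻¹ H ∈ S := by
  constructor
  · rintro ⟨M, hM, rfl⟩
    rwa [act_inv_act]
  · intro hH
    exact ⟨_, hH, act_act_inv g H⟩

/-- Translates of subsets of the cone are subsets of the cone. [folklore] -/
theorem image_act_subset_cone (g : GL (Fin 2) ℂ) {S : Set Mat} (hS : S ⊆ cone) :
    act g '' S ⊆ cone := by
  rintro _ ⟨M, hM, rfl⟩
  exact act_mem_cone g (hS hM)

/-- The action `H ↦ g • H` is `ℝ`-linear. [folklore] -/
theorem isLinearMap_act (g : GL (Fin 2) ℂ) : IsLinearMap ℝ (act g) :=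
  ⟨act_add g, act_smul g⟩

/-- **Translates of convex sets of forms are convex** (the action is linear).
[cite: BorelSerre1973, §11] -/
theorem convex_image_act (g : GL (Fin 2) ℂ) {S : Set Mat} (hS : Convex ℝ S) :
    Convex ℝ (act g '' S) :=
  hS.is_linear_image (isLinearMap_act g)

/-- The intersection of the cone with finitely many translates of a convex set is convex.
[folklore] -/
theorem convex_setOf_mem_cone_forall_mem_image_act {S : Set Mat} (hconv : Convex ℝ S) {m : ℕ}
    (h : Fin m → GL (Fin 2) ℂ) : Convex ℝ {M : Mat | M ∈ cone ∧ ∀ k, M ∈ act (h k) '' S} := by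
  have he : {M : Mat | M ∈ cone ∧ ∀ k, M ∈ act (h k) '' S} = cone ∩ ⋂ k, act (h k) '' S := by
    ext M
    simp only [Set.mem_setOf_eq, Set.mem_inter_iff, Set.mem_iInter]
  rw [he]
  exact convex_cone.inter (convex_iInter fun k => convex_image_act (h k) hconv)

/-! ### Traces on the cone -/

/-- The trace on the cone of a translate `g • S` is the preimage of the trace of `S` under the
homeomorphism `H ↦ g⁻¹ • H` of the cone. [folklore] -/
theorem setOf_mem_image_act_eq (g : GL (Fin 2) ℂ) (S : Set Mat) :
    {H : ↥cone | (H : Mat) ∈ act g '' S} =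
      (fun H : ↥cone => g⁻¹ • H) ⁻¹' {H : ↥cone | (H : Mat) ∈ S} := by
  ext H
  simp only [Set.mem_setOf_eq, Set.mem_preimage, coe_smul_cone, mem_image_act_iff]

/-- **Translates of relatively open subsets of the cone are relatively open.** [folklore] -/
theorem isOpen_setOf_mem_image_act (g : GL (Fin 2) ℂ) {S : Set Mat}
    (ho : IsOpen {H : ↥cone | (H : Mat) ∈ S}) : IsOpen {H : ↥cone | (H : Mat) ∈ act g '' S} := by
  rw [setOf_mem_image_act_eq]
  exact ho.preimage (continuous_const_smul _)

/-- **Finite intersections of translates of a relatively open subset are open in the cone.**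
[folklore] -/
theorem isOpen_setOf_forall_mem_image_act {S : Set Mat} (ho : IsOpen {H : ↥cone | (H : Mat) ∈ S})
    {m : ℕ} (h : Fin m → GL (Fin 2) ℂ) :
    IsOpen {H : ↥cone | ∀ k, (H : Mat) ∈ act (h k) '' S} := by
  rw [Set.setOf_forall]
  exact isOpen_iInter_of_finite fun k => isOpen_setOf_mem_image_act (h k) ho

/-- **Non-empty finite intersections of translates of a convex set, traced on the cone, are
contractible**: the trace is homeomorphic to the non-empty convex subset `𝒫 ∩ ⋂ₖ h_k • S` of the
real vector space `M₂(ℂ)`. [cite: HatcherAT2002, §2.1] -/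
theorem contractibleSpace_setOf_forall_mem_image_act {S : Set Mat} (hconv : Convex ℝ S) {m : ℕ}
    (h : Fin m → GL (Fin 2) ℂ) (hne : ∃ H : ↥cone, ∀ k, (H : Mat) ∈ act (h k) '' S) :
    ContractibleSpace ↥{H : ↥cone | ∀ k, (H : Mat) ∈ act (h k) '' S} := by
  haveI : ContractibleSpace ↥{M : Mat | M ∈ cone ∧ ∀ k, M ∈ act (h k) '' S} := by
    obtain ⟨H, hH⟩ := hne
    exact (convex_setOf_mem_cone_forall_mem_image_act hconv h).contractibleSpace ⟨H, H.2, hH⟩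
  let e : ↥{H : ↥cone | ∀ k, (H : Mat) ∈ act (h k) '' S} ≃ₜ
      ↥{M : Mat | M ∈ cone ∧ ∀ k, M ∈ act (h k) '' S} :=
    { toFun := fun H => ⟨(H : ↥cone), H.1.2, H.2⟩
      invFun := fun M => ⟨⟨M, M.2.1⟩, M.2.2⟩
      left_inv := fun _ => rfl
      right_inv := fun _ => rfl
      continuous_toFun := (continuous_subtype_val.comp continuous_subtype_val).subtype_mk _
      continuous_invFun := (continuous_subtype_val.subtype_mk _).subtype_mk _ }
  exact e.contractibleSpace

/-- **Translates of a convex, relatively open subset of the cone: open, and non-empty finite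
intersections contractible.**  For a convex `S ⊆ 𝒫` whose trace on the cone is open in the cone and
finitely many `h_k ∈ GL₂(ℂ)`, the set of points of the cone lying in every translate `h_k • S` is
open in the cone and, if non-empty, contractible (each `h_k • S` is convex since the action is
linear, so the set is a non-empty convex subset of `M₂(ℂ)`).  This is the good-cover hypothesis of
Leray's theorem for the cover of `𝒫` by the translates of a Siegel set ([BorelSerre1973, §11]);
the hypothesis `S ⊆ 𝒫` is part of the interface but not needed for the conclusion.
[cite: BorelSerre1973, §11] -/
theorem isOpen_contractible_translates {S : Set Mat} (_hS : S ⊆ cone)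
    (ho : IsOpen {H : ↥cone | (H : Mat) ∈ S})
    (hconv : Convex ℝ S) {m : ℕ} (h : Fin m → GL (Fin 2) ℂ) :
    IsOpen {H : ↥cone | ∀ k, (H : Mat) ∈ act (h k) '' S} ∧
    ((∃ H : ↥cone, ∀ k, (H : Mat) ∈ act (h k) '' S) →
      ContractibleSpace ↥{H : ↥cone | ∀ k, (H : Mat) ∈ act (h k) '' S}) :=
  ⟨isOpen_setOf_forall_mem_image_act ho h, contractibleSpace_setOf_forall_mem_image_act hconv h⟩

end BianchiCone

end Literature.NumberTheory.Automorphic
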